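import Literature.NumberTheory.NumberFields.CyclotomicFieldFourValuations
import Literature.NumberTheory.NumberFields.EisensteinFieldPrimes
import Mathlib.Tactic.NormNum.Prime
import HarnessLib

/-!
# The Eisenstein valuation table of the `5`-descent of `E_{13/14}` over `ℚ(ζ₃)`: five places, six Kummer values

PROOF-ONLY file (theorems only, no definition, no named fact, no `sorry`), topic `NumberTheory/EllipticCurves`;
the arithmetic input of the instance `KubertTate1314EisensteinDescent` — the first complete `5`-descent over the
Eisenstein field `ℚ(ζ₃) = ℚ(√-3)` with SPLIT primes in `mn` (the tree's `KubertTateFiveEisensteinTwist` only used the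
automatic box, i.e. twists of rank `≤ 1`).  Carrier: the tree's model `K3` of `ℚ(ζ₃)` (`EisensteinField`,
`EisensteinFieldIntegers`, `EisensteinFieldPrimes`: `𝓞 K3 = ℤ[ζ₃]`, `mkInt a b = a + bζ₃`).

`E = E_{13/14} = [1, -182, -2548, 0, 0]` (`kubertTateFive 13 14`), `mn = 182 = 2·7·13` with `7, 13 ≡ 1 (mod 3)`
SPLIT in `ℤ[ζ₃]` and `2` inert: the five places of `ℚ(ζ₃)` above `mn` are `v₀ = (2)`, `v₁ = (3 + ζ₃)`,
`v₂ = (2 − ζ₃)`, `v₃ = (4 + ζ₃)`, `v₄ = (3 − ζ₃)` (`exists_places`; norms `4, 7, 7, 13, 13`).  The six Kummer values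
`f_T = xy − 14x² + 196y` are those of the `ℚ`-points `−T = (0, 2548)`, `P₁ = (-78, 936)`, `P₂ = (98, 392)`
(`499408`, `25272`, `-19208`; tree `KubertTate1314Torsion` / `KubertTate1314Rank`), of the two `ℚ(ζ₃)`-points
`R₁ = (96 + 50ζ₃, 396 + 320ζ₃)`, `R₂ = (120 − 40ζ₃, 700 + 200ζ₃)` (`5608 − 2160ζ₃`, `50000 + 200000ζ₃`) — genuine
`ℚ(ζ₃)`-points of `E`, whose differences with their conjugates are the points `u = -637/3`, `u = -19747/243` of the
quadratic twist `-3Y² = 4u³ + b₂u² + 2b₄u + b₆` of `E` by `-3` — and of the base point `2T = (182, 2366)`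
(`430612 = 13³·14²`).  Their orders at the five places (`log_valuation_points`, `log_valuation_base`; Mathlib
normalisation `log v = -ord_v`):

  `ord = [[4, 4, 4, 1, 1], [3, 0, 0, 1, 1], [3, 4, 4, 0, 0], [3, 0, 3, 3, 0], [4, 0, 0, 0, 1]]`, base `[2, 2, 2, 3, 3]`,

each certified by an explicit factorisation `α = πᵏ·y` with `y = π·z + d`, `ℓ ∤ d ∈ ℤ` (split `π` above `ℓ = 7, 13`)
or `y = a + bζ₃` with `a` or `b` odd (the inert prime `2`), found by exact division in `ℤ[ζ₃]` and checked here by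
`mkInt` arithmetic (`mkInt_mul`, `mkInt_add`, `mkInt_inj`).  The two `ℚ(ζ₃)`-rows DIFFER at the conjugate places
`v₁ ≠ v₂`, `v₃ ≠ v₄`: this is what no `ℚ`-point can do and what makes the `5 × 5` Kummer matrix invertible mod `5`
(sequel `KubertTate1314EisensteinDescent`).  BSD is not proved by this.

## References

* [SilvermanAEC2009] J. H. Silverman, *AEC*, 2nd ed., Exercise 10.1(c), Thm. X.1.1 (the descent values `f_T(P)`
  and their prime supports).
* [IrelandRosen1982] K. Ireland, M. Rosen, *A Classical Introduction to Modern Number Theory*, Ch. 9 §1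
  Prop. 9.1.4 (the primes of `ℤ[ω]`).
-/

noncomputable section

open scoped NumberField
open NumberField Ideal IsDedekindDomain Literature.NumberTheory.NumberFields
open Literature.NumberTheory.NumberFields.K3

namespace Literature.NumberTheory.EllipticCurves

namespace KubertTate1314EisensteinDescent

/-! ## §1 The five places of `ℚ(ζ₃)` above `mn = 2·7·13` -/

/-- **The places `(2)`, `(3 + ζ₃)`, `(2 − ζ₃)`, `(4 + ζ₃)`, `(3 − ζ₃)` of `ℚ(ζ₃)`** (prime elements of norms
`4, 7, 7, 13, 13`: `2` is inert, `7 = (3 + ζ₃)(2 − ζ₃)` and `13 = (4 + ζ₃)(3 − ζ₃)` split).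
[cite: IrelandRosen1982, Ch. 9 §1 Prop. 9.1.4] -/
theorem exists_places :
    ∃ v₀ v₁ v₂ v₃ v₄ : HeightOneSpectrum (𝓞 K3),
      v₀.asIdeal = span {(2 : 𝓞 K3)} ∧ v₁.asIdeal = span {mkInt 3 1} ∧
      v₂.asIdeal = span {mkInt 2 (-1)} ∧ v₃.asIdeal = span {mkInt 4 1} ∧
      v₄.asIdeal = span {mkInt 3 (-1)} := by
  have p₀ : Prime (2 : 𝓞 K3) := prime_two
  have p₁ : Prime (mkInt 3 1) := prime_mkInt_of_norm_eq_prime (p := 7) (by norm_num) (by norm_num)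
  have p₂ : Prime (mkInt 2 (-1)) := prime_mkInt_of_norm_eq_prime (p := 7) (by norm_num) (by norm_num)
  have p₃ : Prime (mkInt 4 1) := prime_mkInt_of_norm_eq_prime (p := 13) (by norm_num) (by norm_num)
  have p₄ : Prime (mkInt 3 (-1)) := prime_mkInt_of_norm_eq_prime (p := 13) (by norm_num) (by norm_num)
  obtain ⟨v₀, h₀⟩ := exists_asIdeal_eq_span p₀
  obtain ⟨v₁, h₁⟩ := exists_asIdeal_eq_span p₁
  obtain ⟨v₂, h₂⟩ := exists_asIdeal_eq_span p₂
  obtain ⟨v₃, h₃⟩ := exists_asIdeal_eq_span p₃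
  obtain ⟨v₄, h₄⟩ := exists_asIdeal_eq_span p₄
  exact ⟨v₀, v₁, v₂, v₃, v₄, h₀, h₁, h₂, h₃, h₄⟩

/-! ## §2 The valuation table -/

section Table

variable {v₀ v₁ v₂ v₃ v₄ : HeightOneSpectrum (𝓞 K3)}
  (hv₀ : v₀.asIdeal = span {(2 : 𝓞 K3)}) (hv₁ : v₁.asIdeal = span {mkInt 3 1})
  (hv₂ : v₂.asIdeal = span {mkInt 2 (-1)}) (hv₃ : v₃.asIdeal = span {mkInt 4 1})
  (hv₄ : v₄.asIdeal = span {mkInt 3 (-1)})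

include hv₀ hv₁ hv₂ hv₃ hv₄

/-- The rational primes `2, 7, 7, 13, 13` lie in the five places (`7 = (3 + ζ₃)(2 − ζ₃)`, `13 = (4 + ζ₃)(3 − ζ₃)`).
[cite: IrelandRosen1982, Ch. 9 §1 Prop. 9.1.4] -/
theorem natCast_mem_places :
    ((2 : ℕ) : 𝓞 K3) ∈ v₀.asIdeal ∧ ((7 : ℕ) : 𝓞 K3) ∈ v₁.asIdeal ∧ ((7 : ℕ) : 𝓞 K3) ∈ v₂.asIdeal ∧
      ((13 : ℕ) : 𝓞 K3) ∈ v₃.asIdeal ∧ ((13 : ℕ) : 𝓞 K3) ∈ v₄.asIdeal := by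
  refine ⟨?_, ?_, ?_, ?_, ?_⟩
  · rw [hv₀, mem_span_singleton]; exact ⟨1, by norm_num⟩
  · rw [hv₁, mem_span_singleton]
    exact ⟨mkInt 2 (-1), by
      rw [mkInt_mul, show ((7 : ℕ) : 𝓞 K3) = ((7 : ℤ) : 𝓞 K3) by norm_cast, ← mkInt_intCast, mkInt_inj]; norm_num⟩
  · rw [hv₂, mem_span_singleton]
    exact ⟨mkInt 3 1, by
      rw [mkInt_mul, show ((7 : ℕ) : 𝓞 K3) = ((7 : ℤ) : 𝓞 K3) by norm_cast, ← mkInt_intCast, mkInt_inj]; norm_num⟩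
  · rw [hv₃, mem_span_singleton]
    exact ⟨mkInt 3 (-1), by
      rw [mkInt_mul, show ((13 : ℕ) : 𝓞 K3) = ((13 : ℤ) : 𝓞 K3) by norm_cast, ← mkInt_intCast, mkInt_inj]; norm_num⟩
  · rw [hv₄, mem_span_singleton]
    exact ⟨mkInt 4 1, by
      rw [mkInt_mul, show ((13 : ℕ) : 𝓞 K3) = ((13 : ℤ) : 𝓞 K3) by norm_cast, ← mkInt_intCast, mkInt_inj]; norm_num⟩

/-- **The orders of the five Kummer values at the five places**: `ord_{v_j} f_T(P_i)` for
`P₀ = −T`, `P₁ = (-78, 936)`, `P₂ = (98, 392)`, `P₃ = R₁ = (96 + 50ζ₃, 396 + 320ζ₃)`, `P₄ = R₂ = (120 − 40ζ₃, 700 + 200ζ₃)`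
(values `499408`, `25272`, `-19208`, `5608 − 2160ζ₃`, `50000 + 200000ζ₃`) is the matrix
`[[4, 4, 4, 1, 1], [3, 0, 0, 1, 1], [3, 4, 4, 0, 0], [3, 0, 3, 3, 0], [4, 0, 0, 0, 1]]` (read as `log v = -ord`). [cite: SilvermanAEC2009, Exercise 10.1(c)] -/
theorem log_valuation_points : ∀ i j : Fin 5,
    WithZero.log ((![v₀, v₁, v₂, v₃, v₄] j).valuation K3
      ((![(mkInt 499408 0 : 𝓞 K3), (mkInt 25272 0 : 𝓞 K3), (mkInt (-19208) 0 : 𝓞 K3), (mkInt 5608 (-2160) : 𝓞 K3), (mkInt 50000 200000 : 𝓞 K3)] i : 𝓞 K3) : K3)) =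
      -((![![4, 4, 4, 1, 1], ![3, 0, 0, 1, 1], ![3, 4, 4, 0, 0], ![3, 0, 3, 3, 0], ![4, 0, 0, 0, 1]] : Fin 5 → Fin 5 → ℕ) i j : ℤ) := by
  have e2 : (2 : 𝓞 K3) = mkInt 2 0 := by rw [mkInt_intCast]; norm_num
  have e2' : (2 : 𝓞 K3) = ((2 : ℤ) : 𝓞 K3) := by norm_num
  obtain ⟨hℓ₀, hℓ₁, hℓ₂, hℓ₃, hℓ₄⟩ := natCast_mem_places hv₀ hv₁ hv₂ hv₃ hv₄
  have hπ₁ : mkInt 3 1 ∈ v₁.asIdeal := by rw [hv₁]; exact mem_span_singleton_self _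
  have hπ₂ : mkInt 2 (-1) ∈ v₂.asIdeal := by rw [hv₂]; exact mem_span_singleton_self _
  have hπ₃ : mkInt 4 1 ∈ v₃.asIdeal := by rw [hv₃]; exact mem_span_singleton_self _
  have hπ₄ : mkInt 3 (-1) ∈ v₄.asIdeal := by rw [hv₄]; exact mem_span_singleton_self _
  have c00 : WithZero.log (v₀.valuation K3 ((mkInt 499408 0 : 𝓞 K3) : K3)) = -4 := by
    rw [log_valuation_eq_neg_of_eq_pow_mul hv₀ 4 (y := mkInt 31213 0)
      (by rw [e2]; simp only [pow_succ, pow_zero, one_mul, mkInt_mul, mkInt_inj]; norm_num)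
      (fun h ↦ by
        rw [hv₀, mem_span_singleton, e2', intCast_dvd_mkInt_iff] at h
        omega)]
    norm_num
  have c01 : WithZero.log (v₁.valuation K3 ((mkInt 499408 0 : 𝓞 K3) : K3)) = -4 := by
    rw [log_valuation_eq_neg_of_eq_pow_mul hv₁ 4 (y := mkInt (-3328) (-11440))
      (by simp only [pow_succ, pow_zero, one_mul, mkInt_mul, mkInt_inj]; norm_num)
      (not_mem_of_eq_mul_add_intCast (ℓ := 7) (by norm_num) hℓ₁ hπ₁ (z := mkInt (-2586) (-4427)) (d := 3)
        (by rw [mkInt_mul, ← mkInt_intCast, mkInt_add, mkInt_inj]; norm_num) (by norm_num))]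
    norm_num
  have c02 : WithZero.log (v₂.valuation K3 ((mkInt 499408 0 : 𝓞 K3) : K3)) = -4 := by
    rw [log_valuation_eq_neg_of_eq_pow_mul hv₂ 4 (y := mkInt 8112 11440)
      (by simp only [pow_succ, pow_zero, one_mul, mkInt_mul, mkInt_inj]; norm_num)
      (not_mem_of_eq_mul_add_intCast (ℓ := 7) (by norm_num) hℓ₂ hπ₂ (z := mkInt 1841 4427) (d := 3)
        (by rw [mkInt_mul, ← mkInt_intCast, mkInt_add, mkInt_inj]; norm_num) (by norm_num))]
    norm_num
  have c03 : WithZero.log (v₃.valuation K3 ((mkInt 499408 0 : 𝓞 K3) : K3)) = -1 := by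
    rw [log_valuation_eq_neg_of_eq_pow_mul hv₃ 1 (y := mkInt 115248 (-38416))
      (by simp only [pow_succ, pow_zero, one_mul, mkInt_mul, mkInt_inj]; norm_num)
      (not_mem_of_eq_mul_add_intCast (ℓ := 13) (by norm_num) hℓ₃ hπ₃ (z := mkInt 23639 (-20685)) (d := 7)
        (by rw [mkInt_mul, ← mkInt_intCast, mkInt_add, mkInt_inj]; norm_num) (by norm_num))]
    norm_num
  have c04 : WithZero.log (v₄.valuation K3 ((mkInt 499408 0 : 𝓞 K3) : K3)) = -1 := by
    rw [log_valuation_eq_neg_of_eq_pow_mul hv₄ 1 (y := mkInt 153664 38416)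
      (by simp only [pow_succ, pow_zero, one_mul, mkInt_mul, mkInt_inj]; norm_num)
      (not_mem_of_eq_mul_add_intCast (ℓ := 13) (by norm_num) hℓ₄ hπ₄ (z := mkInt 44324 20685) (d := 7)
        (by rw [mkInt_mul, ← mkInt_intCast, mkInt_add, mkInt_inj]; norm_num) (by norm_num))]
    norm_num
  have c10 : WithZero.log (v₀.valuation K3 ((mkInt 25272 0 : 𝓞 K3) : K3)) = -3 := by
    rw [log_valuation_eq_neg_of_eq_pow_mul hv₀ 3 (y := mkInt 3159 0)
      (by rw [e2]; simp only [pow_succ, pow_zero, one_mul, mkInt_mul, mkInt_inj]; norm_num)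
      (fun h ↦ by
        rw [hv₀, mem_span_singleton, e2', intCast_dvd_mkInt_iff] at h
        omega)]
    norm_num
  have c11 : WithZero.log (v₁.valuation K3 ((mkInt 25272 0 : 𝓞 K3) : K3)) = -0 := by
    rw [log_valuation_eq_neg_of_eq_pow_mul hv₁ 0 (y := mkInt 25272 0)
      (by rw [pow_zero, one_mul])
      (not_mem_of_eq_mul_add_intCast (ℓ := 7) (by norm_num) hℓ₁ hπ₁ (z := mkInt 7220 (-3610)) (d := 2)
        (by rw [mkInt_mul, ← mkInt_intCast, mkInt_add, mkInt_inj]; norm_num) (by norm_num))]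
    norm_num
  have c12 : WithZero.log (v₂.valuation K3 ((mkInt 25272 0 : 𝓞 K3) : K3)) = -0 := by
    rw [log_valuation_eq_neg_of_eq_pow_mul hv₂ 0 (y := mkInt 25272 0)
      (by rw [pow_zero, one_mul])
      (not_mem_of_eq_mul_add_intCast (ℓ := 7) (by norm_num) hℓ₂ hπ₂ (z := mkInt 10830 3610) (d := 2)
        (by rw [mkInt_mul, ← mkInt_intCast, mkInt_add, mkInt_inj]; norm_num) (by norm_num))]
    norm_num
  have c13 : WithZero.log (v₃.valuation K3 ((mkInt 25272 0 : 𝓞 K3) : K3)) = -1 := by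
    rw [log_valuation_eq_neg_of_eq_pow_mul hv₃ 1 (y := mkInt 5832 (-1944))
      (by simp only [pow_succ, pow_zero, one_mul, mkInt_mul, mkInt_inj]; norm_num)
      (not_mem_of_eq_mul_add_intCast (ℓ := 13) (by norm_num) hℓ₃ hπ₃ (z := mkInt 1194 (-1046)) (d := 10)
        (by rw [mkInt_mul, ← mkInt_intCast, mkInt_add, mkInt_inj]; norm_num) (by norm_num))]
    norm_num
  have c14 : WithZero.log (v₄.valuation K3 ((mkInt 25272 0 : 𝓞 K3) : K3)) = -1 := by
    rw [log_valuation_eq_neg_of_eq_pow_mul hv₄ 1 (y := mkInt 7776 1944)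
      (by simp only [pow_succ, pow_zero, one_mul, mkInt_mul, mkInt_inj]; norm_num)
      (not_mem_of_eq_mul_add_intCast (ℓ := 13) (by norm_num) hℓ₄ hπ₄ (z := mkInt 2240 1046) (d := 10)
        (by rw [mkInt_mul, ← mkInt_intCast, mkInt_add, mkInt_inj]; norm_num) (by norm_num))]
    norm_num
  have c20 : WithZero.log (v₀.valuation K3 ((mkInt (-19208) 0 : 𝓞 K3) : K3)) = -3 := by
    rw [log_valuation_eq_neg_of_eq_pow_mul hv₀ 3 (y := mkInt (-2401) 0)
      (by rw [e2]; simp only [pow_succ, pow_zero, one_mul, mkInt_mul, mkInt_inj]; norm_num)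
      (fun h ↦ by
        rw [hv₀, mem_span_singleton, e2', intCast_dvd_mkInt_iff] at h
        omega)]
    norm_num
  have c21 : WithZero.log (v₁.valuation K3 ((mkInt (-19208) 0 : 𝓞 K3) : K3)) = -4 := by
    rw [log_valuation_eq_neg_of_eq_pow_mul hv₁ 4 (y := mkInt 128 440)
      (by simp only [pow_succ, pow_zero, one_mul, mkInt_mul, mkInt_inj]; norm_num)
      (not_mem_of_eq_mul_add_intCast (ℓ := 7) (by norm_num) hℓ₁ hπ₁ (z := mkInt 98 171) (d := 5)
        (by rw [mkInt_mul, ← mkInt_intCast, mkInt_add, mkInt_inj]; norm_num) (by norm_num))]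
    norm_num
  have c22 : WithZero.log (v₂.valuation K3 ((mkInt (-19208) 0 : 𝓞 K3) : K3)) = -4 := by
    rw [log_valuation_eq_neg_of_eq_pow_mul hv₂ 4 (y := mkInt (-312) (-440))
      (by simp only [pow_succ, pow_zero, one_mul, mkInt_mul, mkInt_inj]; norm_num)
      (not_mem_of_eq_mul_add_intCast (ℓ := 7) (by norm_num) hℓ₂ hπ₂ (z := mkInt (-73) (-171)) (d := 5)
        (by rw [mkInt_mul, ← mkInt_intCast, mkInt_add, mkInt_inj]; norm_num) (by norm_num))]
    norm_num
  have c23 : WithZero.log (v₃.valuation K3 ((mkInt (-19208) 0 : 𝓞 K3) : K3)) = -0 := by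
    rw [log_valuation_eq_neg_of_eq_pow_mul hv₃ 0 (y := mkInt (-19208) 0)
      (by rw [pow_zero, one_mul])
      (not_mem_of_eq_mul_add_intCast (ℓ := 13) (by norm_num) hℓ₃ hπ₃ (z := mkInt (-4434) 1478) (d := 6)
        (by rw [mkInt_mul, ← mkInt_intCast, mkInt_add, mkInt_inj]; norm_num) (by norm_num))]
    norm_num
  have c24 : WithZero.log (v₄.valuation K3 ((mkInt (-19208) 0 : 𝓞 K3) : K3)) = -0 := by
    rw [log_valuation_eq_neg_of_eq_pow_mul hv₄ 0 (y := mkInt (-19208) 0)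
      (by rw [pow_zero, one_mul])
      (not_mem_of_eq_mul_add_intCast (ℓ := 13) (by norm_num) hℓ₄ hπ₄ (z := mkInt (-5912) (-1478)) (d := 6)
        (by rw [mkInt_mul, ← mkInt_intCast, mkInt_add, mkInt_inj]; norm_num) (by norm_num))]
    norm_num
  have c30 : WithZero.log (v₀.valuation K3 ((mkInt 5608 (-2160) : 𝓞 K3) : K3)) = -3 := by
    rw [log_valuation_eq_neg_of_eq_pow_mul hv₀ 3 (y := mkInt 701 (-270))
      (by rw [e2]; simp only [pow_succ, pow_zero, one_mul, mkInt_mul, mkInt_inj]; norm_num)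
      (fun h ↦ by
        rw [hv₀, mem_span_singleton, e2', intCast_dvd_mkInt_iff] at h
        omega)]
    norm_num
  have c31 : WithZero.log (v₁.valuation K3 ((mkInt 5608 (-2160) : 𝓞 K3) : K3)) = -0 := by
    rw [log_valuation_eq_neg_of_eq_pow_mul hv₁ 0 (y := mkInt 5608 (-2160))
      (by rw [pow_zero, one_mul])
      (not_mem_of_eq_mul_add_intCast (ℓ := 7) (by norm_num) hℓ₁ hπ₁ (z := mkInt 1292 (-1726)) (d := 6)
        (by rw [mkInt_mul, ← mkInt_intCast, mkInt_add, mkInt_inj]; norm_num) (by norm_num))]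
    norm_num
  have c32 : WithZero.log (v₂.valuation K3 ((mkInt 5608 (-2160) : 𝓞 K3) : K3)) = -3 := by
    rw [log_valuation_eq_neg_of_eq_pow_mul hv₂ 3 (y := mkInt 424 288)
      (by simp only [pow_succ, pow_zero, one_mul, mkInt_mul, mkInt_inj]; norm_num)
      (not_mem_of_eq_mul_add_intCast (ℓ := 7) (by norm_num) hℓ₂ hπ₂ (z := mkInt 138 142) (d := 6)
        (by rw [mkInt_mul, ← mkInt_intCast, mkInt_add, mkInt_inj]; norm_num) (by norm_num))]
    norm_num
  have c33 : WithZero.log (v₃.valuation K3 ((mkInt 5608 (-2160) : 𝓞 K3) : K3)) = -3 := by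
    rw [log_valuation_eq_neg_of_eq_pow_mul hv₃ 3 (y := mkInt 8 (-144))
      (by simp only [pow_succ, pow_zero, one_mul, mkInt_mul, mkInt_inj]; norm_num)
      (not_mem_of_eq_mul_add_intCast (ℓ := 13) (by norm_num) hℓ₃ hπ₃ (z := mkInt (-12) (-44)) (d := 12)
        (by rw [mkInt_mul, ← mkInt_intCast, mkInt_add, mkInt_inj]; norm_num) (by norm_num))]
    norm_num
  have c34 : WithZero.log (v₄.valuation K3 ((mkInt 5608 (-2160) : 𝓞 K3) : K3)) = -0 := by
    rw [log_valuation_eq_neg_of_eq_pow_mul hv₄ 0 (y := mkInt 5608 (-2160))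
      (by rw [pow_zero, one_mul])
      (not_mem_of_eq_mul_add_intCast (ℓ := 13) (by norm_num) hℓ₄ hπ₄ (z := mkInt 1888 (-68)) (d := 12)
        (by rw [mkInt_mul, ← mkInt_intCast, mkInt_add, mkInt_inj]; norm_num) (by norm_num))]
    norm_num
  have c40 : WithZero.log (v₀.valuation K3 ((mkInt 50000 200000 : 𝓞 K3) : K3)) = -4 := by
    rw [log_valuation_eq_neg_of_eq_pow_mul hv₀ 4 (y := mkInt 3125 12500)
      (by rw [e2]; simp only [pow_succ, pow_zero, one_mul, mkInt_mul, mkInt_inj]; norm_num)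
      (fun h ↦ by
        rw [hv₀, mem_span_singleton, e2', intCast_dvd_mkInt_iff] at h
        omega)]
    norm_num
  have c41 : WithZero.log (v₁.valuation K3 ((mkInt 50000 200000 : 𝓞 K3) : K3)) = -0 := by
    rw [log_valuation_eq_neg_of_eq_pow_mul hv₁ 0 (y := mkInt 50000 200000)
      (by rw [pow_zero, one_mul])
      (not_mem_of_eq_mul_add_intCast (ℓ := 7) (by norm_num) hℓ₁ hπ₁ (z := mkInt 42856 78572) (d := 4)
        (by rw [mkInt_mul, ← mkInt_intCast, mkInt_add, mkInt_inj]; norm_num) (by norm_num))]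
    norm_num
  have c42 : WithZero.log (v₂.valuation K3 ((mkInt 50000 200000 : 𝓞 K3) : K3)) = -0 := by
    rw [log_valuation_eq_neg_of_eq_pow_mul hv₂ 0 (y := mkInt 50000 200000)
      (by rw [pow_zero, one_mul])
      (not_mem_of_eq_mul_add_intCast (ℓ := 7) (by norm_num) hℓ₂ hπ₂ (z := mkInt (-7145) 64285) (d := 5)
        (by rw [mkInt_mul, ← mkInt_intCast, mkInt_add, mkInt_inj]; norm_num) (by norm_num))]
    norm_num
  have c43 : WithZero.log (v₃.valuation K3 ((mkInt 50000 200000 : 𝓞 K3) : K3)) = -0 := by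
    rw [log_valuation_eq_neg_of_eq_pow_mul hv₃ 0 (y := mkInt 50000 200000)
      (by rw [pow_zero, one_mul])
      (not_mem_of_eq_mul_add_intCast (ℓ := 13) (by norm_num) hℓ₃ hπ₃ (z := mkInt 26921 57693) (d := 9)
        (by rw [mkInt_mul, ← mkInt_intCast, mkInt_add, mkInt_inj]; norm_num) (by norm_num))]
    norm_num
  have c44 : WithZero.log (v₄.valuation K3 ((mkInt 50000 200000 : 𝓞 K3) : K3)) = -1 := by
    rw [log_valuation_eq_neg_of_eq_pow_mul hv₄ 1 (y := mkInt 0 50000)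
      (by simp only [pow_succ, pow_zero, one_mul, mkInt_mul, mkInt_inj]; norm_num)
      (not_mem_of_eq_mul_add_intCast (ℓ := 13) (by norm_num) hℓ₄ hπ₄ (z := mkInt (-3848) 11538) (d := 6)
        (by rw [mkInt_mul, ← mkInt_intCast, mkInt_add, mkInt_inj]; norm_num) (by norm_num))]
    norm_num
  intro i j
  fin_cases i <;> fin_cases j
  · simpa using c00
  · simpa using c01
  · simpa using c02
  · simpa using c03
  · simpa using c04
  · simpa using c10
  · simpa using c11
  · simpa using c12
  · simpa using c13
  · simpa using c14
  · simpa using c20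
  · simpa using c21
  · simpa using c22
  · simpa using c23
  · simpa using c24
  · simpa using c30
  · simpa using c31
  · simpa using c32
  · simpa using c33
  · simpa using c34
  · simpa using c40
  · simpa using c41
  · simpa using c42
  · simpa using c43
  · simpa using c44

/-- **The orders of the base value `f_T(2T) = 430612 = 2²·7²·13³` at the five places**: `[2, 2, 2, 3, 3]`.
[cite: SilvermanAEC2009, Exercise 10.1(c)] -/
theorem log_valuation_base : ∀ j : Fin 5,
    WithZero.log ((![v₀, v₁, v₂, v₃, v₄] j).valuation K3 (((mkInt 430612 0 : 𝓞 K3) : 𝓞 K3) : K3)) =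
      -((![2, 2, 2, 3, 3] : Fin 5 → ℕ) j : ℤ) := by
  have e2 : (2 : 𝓞 K3) = mkInt 2 0 := by rw [mkInt_intCast]; norm_num
  have e2' : (2 : 𝓞 K3) = ((2 : ℤ) : 𝓞 K3) := by norm_num
  obtain ⟨hℓ₀, hℓ₁, hℓ₂, hℓ₃, hℓ₄⟩ := natCast_mem_places hv₀ hv₁ hv₂ hv₃ hv₄
  have hπ₁ : mkInt 3 1 ∈ v₁.asIdeal := by rw [hv₁]; exact mem_span_singleton_self _
  have hπ₂ : mkInt 2 (-1) ∈ v₂.asIdeal := by rw [hv₂]; exact mem_span_singleton_self _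
  have hπ₃ : mkInt 4 1 ∈ v₃.asIdeal := by rw [hv₃]; exact mem_span_singleton_self _
  have hπ₄ : mkInt 3 (-1) ∈ v₄.asIdeal := by rw [hv₄]; exact mem_span_singleton_self _
  have c50 : WithZero.log (v₀.valuation K3 ((mkInt 430612 0 : 𝓞 K3) : K3)) = -2 := by
    rw [log_valuation_eq_neg_of_eq_pow_mul hv₀ 2 (y := mkInt 107653 0)
      (by rw [e2]; simp only [pow_succ, pow_zero, one_mul, mkInt_mul, mkInt_inj]; norm_num)
      (fun h ↦ by
        rw [hv₀, mem_span_singleton, e2', intCast_dvd_mkInt_iff] at h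
        omega)]
    norm_num
  have c51 : WithZero.log (v₁.valuation K3 ((mkInt 430612 0 : 𝓞 K3) : K3)) = -2 := by
    rw [log_valuation_eq_neg_of_eq_pow_mul hv₁ 2 (y := mkInt 26364 (-43940))
      (by simp only [pow_succ, pow_zero, one_mul, mkInt_mul, mkInt_inj]; norm_num)
      (not_mem_of_eq_mul_add_intCast (ℓ := 7) (by norm_num) hℓ₁ hπ₁ (z := mkInt 1254 (-22597)) (d := 5)
        (by rw [mkInt_mul, ← mkInt_intCast, mkInt_add, mkInt_inj]; norm_num) (by norm_num))]
    norm_num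
  have c52 : WithZero.log (v₂.valuation K3 ((mkInt 430612 0 : 𝓞 K3) : K3)) = -2 := by
    rw [log_valuation_eq_neg_of_eq_pow_mul hv₂ 2 (y := mkInt 70304 43940)
      (by simp only [pow_succ, pow_zero, one_mul, mkInt_mul, mkInt_inj]; norm_num)
      (not_mem_of_eq_mul_add_intCast (ℓ := 7) (by norm_num) hℓ₂ hπ₂ (z := mkInt 23851 22597) (d := 5)
        (by rw [mkInt_mul, ← mkInt_intCast, mkInt_add, mkInt_inj]; norm_num) (by norm_num))]
    norm_num
  have c53 : WithZero.log (v₃.valuation K3 ((mkInt 430612 0 : 𝓞 K3) : K3)) = -3 := by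
    rw [log_valuation_eq_neg_of_eq_pow_mul hv₃ 3 (y := mkInt 3332 (-7056))
      (by simp only [pow_succ, pow_zero, one_mul, mkInt_mul, mkInt_inj]; norm_num)
      (not_mem_of_eq_mul_add_intCast (ℓ := 13) (by norm_num) hℓ₃ hπ₃ (z := mkInt 225 (-2427)) (d := 5)
        (by rw [mkInt_mul, ← mkInt_intCast, mkInt_add, mkInt_inj]; norm_num) (by norm_num))]
    norm_num
  have c54 : WithZero.log (v₄.valuation K3 ((mkInt 430612 0 : 𝓞 K3) : K3)) = -3 := by
    rw [log_valuation_eq_neg_of_eq_pow_mul hv₄ 3 (y := mkInt 10388 7056)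
      (by simp only [pow_succ, pow_zero, one_mul, mkInt_mul, mkInt_inj]; norm_num)
      (not_mem_of_eq_mul_add_intCast (ℓ := 13) (by norm_num) hℓ₄ hπ₄ (z := mkInt 2652 2427) (d := 5)
        (by rw [mkInt_mul, ← mkInt_intCast, mkInt_add, mkInt_inj]; norm_num) (by norm_num))]
    norm_num
  intro j
  fin_cases j
  · simpa using c50
  · simpa using c51
  · simpa using c52
  · simpa using c53
  · simpa using c54

end Table

end KubertTate1314EisensteinDescent

end Literature.NumberTheory.EllipticCurves

end
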